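import Summits.MatrixMultiplication.OmegaCensus.SmallFormats.RankOnePlaneCapEqualityCol
import HarnessLib

/-!
# ω-census family (a): the BLOCK law of a saturated column plane (restricted Brent identity)

Cell `pub-omega` (unit `pub-omega-tensor`, gen 28), topic `Summits/MatrixMultiplication/OmegaCensus`
(sub-folder `SmallFormats`). Framing (verbatim): lottery ticket; floor = certified bounds/negative
ranges. HONEST FRAMING: an elementary corollary of the saturated column-plane law
`card_vanishing_col_eq_two_mul_sub`, written out because the structured searches of the 𝔽₃
`⟨2,2,5⟩@17` X-marginal census cite it (the "⟨2,1,2⟩ block split" of the gauge-SAT encoder): if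
exactly `|R| = 2r − 6n` X-forms of a computation of `⟨2,2,n⟩` vanish on the column plane
`{z λᵀ}`, then for the `θ ⊥ λ` and the space `E = span{θᵀG_i : i ∉ R}` produced by the law, every
Y-form `g_i`, `i ∉ R`, VANISHES on the matrices `θ wᵀ` with `w ⊥ E`, and consequently the `|R|`
terms alone compute `X θ wᵀ` there:
`X · θ wᵀ = ∑_{i ∈ R} f_i(X) g_i(θ wᵀ) · W_i` for all `X` and all `w ⊥ E`.
(Together with `f_i(zλᵀ) = 0`, i.e. `f_i` factoring through `X ↦ Xθ`, this says that the `R`-terms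
form a rank-`|R|` computation of the outer product `(Xθ) ⊗ w`; for `⟨2,2,5⟩@17` (`|R| = 4`) the four
`2 × 2` output blocks are then the Frobenius-dual basis of `{a_i b_iᵀ}` — that finite consequence is
re-derived by the encoder, not stated here.) Not a bound on any rank, not progress on `ω`.
-/

namespace Summit.MatrixMultiplication.OmegaCensus.RankOnePlaneCapGeneral

open Module Matrix Literature.Computability.AlgebraicComplexity

variable {k : Type*} [Field k] {c n : ℕ}

/-- A linear form on matrices expands over the elementary matrices:
`g Y = ∑_{μ,ν} Y μ ν · g(E_{μν})`. -/
theorem dual_apply_eq_sum_single (g : Module.Dual k (Matrix (Fin c) (Fin n) k))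
    (Y : Matrix (Fin c) (Fin n) k) :
    g Y = ∑ μ, ∑ ν, Y μ ν * g (Matrix.single μ ν (1 : k)) := by
  conv_lhs => rw [matrix_eq_sum_single Y]
  rw [map_sum]
  refine Finset.sum_congr rfl fun μ _ => ?_
  rw [map_sum]
  refine Finset.sum_congr rfl fun ν _ => ?_
  rw [show Matrix.single μ ν (Y μ ν) = Y μ ν • Matrix.single μ ν (1 : k) by
    rw [smul_single, smul_eq_mul, mul_one], map_smul, smul_eq_mul]

/-- On a rank-one matrix `θ wᵀ` a linear form `g` evaluates to `(θᵀ G) · w`, where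
`G μ ν = g(E_{μν})` is its coefficient matrix. -/
theorem dual_apply_vecMulVec (g : Module.Dual k (Matrix (Fin c) (Fin n) k))
    (θ : Fin c → k) (w : Fin n → k) :
    g (vecMulVec θ w) = (θ ᵥ* Matrix.of fun μ ν => g (Matrix.single μ ν (1 : k))) ⬝ᵥ w := by
  rw [dual_apply_eq_sum_single]
  simp only [vecMulVec_apply, dotProduct, vecMul, Matrix.of_apply]
  rw [Finset.sum_comm]
  refine Finset.sum_congr rfl fun ν _ => ?_
  rw [Finset.sum_mul]
  exact Finset.sum_congr rfl fun μ _ => by ring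

variable {ι : Type*} [Fintype ι]

/-- **Block law of a saturated column plane** (`⟨2,2,n⟩`; restricted Brent identity). If exactly
`|R| = 2r − 6n` X-forms vanish on the column plane `{z λᵀ : z ∈ k²}` (`λ ≠ 0`), then with the
`θ ⊥ λ` and `E = span{θᵀ G_i : i ∉ R}` (`dim E = |Rᶜ| − 2n`) of the saturated law
`card_vanishing_col_eq_two_mul_sub`: for every `w` orthogonal to `E`, every Y-form `g_i` with
`i ∉ R` vanishes at `θ wᵀ`, and the `R`-terms alone compute `X θ wᵀ`:
`X · θ wᵀ = ∑_{i ∈ R} f_i(X) g_i(θ wᵀ) · W_i` for all `X`. -/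
theorem mul_vecMulVec_eq_sum_filter_of_card_eq [DecidableEq ι]
    (β : BilinComp (mulBilin k 2 2 n) ι)
    {lam : Fin 2 → k} (hlam : lam ≠ 0) (R : Finset ι)
    (hR : ∀ i ∈ R, ∀ z : Fin 2 → k, β.f i (vecMulVec z lam) = 0)
    (heq : R.card + 6 * n = 2 * Fintype.card ι) :
    ∃ (θ : Fin 2 → k) (E : Submodule k (Fin n → k)),
      θ ≠ 0 ∧ θ ⬝ᵥ lam = 0 ∧
      E = Submodule.span k
        ((fun i => θ ᵥ* Matrix.of fun μ ν => β.g i (Matrix.single μ ν (1 : k))) ''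
          ↑(Finset.univ \ R)) ∧
      finrank k E + 2 * n = (Finset.univ \ R).card ∧
      (∀ w : Fin n → k, (∀ e ∈ E, e ⬝ᵥ w = 0) →
        (∀ i ∈ Finset.univ \ R, β.g i (vecMulVec θ w) = 0) ∧
        ∀ X : Matrix (Fin 2) (Fin 2) k,
          X * vecMulVec θ w = ∑ i ∈ R, (β.f i X * β.g i (vecMulVec θ w)) • β.w i) := by
  obtain ⟨θ, E, hθ, hθlam, hE, hdim, _, _⟩ := card_vanishing_col_eq_two_mul_sub β hlam R hR heq
  refine ⟨θ, E, hθ, hθlam, hE, hdim, fun w hw => ?_⟩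
  have hvan : ∀ i ∈ Finset.univ \ R, β.g i (vecMulVec θ w) = 0 := by
    intro i hi
    rw [dual_apply_vecMulVec]
    apply hw
    rw [hE]
    exact Submodule.subset_span ⟨i, Finset.mem_coe.mpr hi, rfl⟩
  refine ⟨hvan, fun X => ?_⟩
  have h := β.map_eq_sum X (vecMulVec θ w)
  rw [mulBilin_apply] at h
  rw [h, ← Finset.sum_sdiff (Finset.subset_univ R),
    Finset.sum_eq_zero (fun i hi => by rw [hvan i hi, mul_zero, zero_smul]), zero_add]

/-- In `k²`: if `θ ≠ 0`, `λ ≠ 0` and `θ ⊥ λ`, then every vector orthogonal to `θ` is a multiple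
of `λ` (the orthogonal complement of a nonzero vector in the plane is the line through `λ`). -/
theorem exists_eq_smul_of_dotProduct_eq_zero {θ lam x : Fin 2 → k} (hθ : θ ≠ 0)
    (hlam : lam ≠ 0) (hθlam : θ ⬝ᵥ lam = 0) (hx : x ⬝ᵥ θ = 0) : ∃ a : k, x = a • lam := by
  have hθlam' : θ 0 * lam 0 + θ 1 * lam 1 = 0 := by
    simpa [dotProduct, Fin.sum_univ_two] using hθlam
  have hx' : x 0 * θ 0 + x 1 * θ 1 = 0 := by simpa [dotProduct, Fin.sum_univ_two] using hx
  by_cases h0 : θ 0 = 0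
  · -- then `θ 1 ≠ 0`, so `lam 1 = 0`, `lam 0 ≠ 0`, `x 1 = 0`
    have h1 : θ 1 ≠ 0 := by
      intro h1
      apply hθ
      funext i
      fin_cases i <;> simp [h0, h1]
    have hl1 : lam 1 = 0 := by
      have : θ 1 * lam 1 = 0 := by simpa [h0] using hθlam'
      exact (mul_eq_zero.mp this).resolve_left h1
    have hl0 : lam 0 ≠ 0 := by
      intro hl0
      apply hlam
      funext i
      fin_cases i <;> simp [hl0, hl1]
    have hx1 : x 1 = 0 := by
      have : x 1 * θ 1 = 0 := by simpa [h0] using hx'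
      exact (mul_eq_zero.mp this).resolve_right h1
    refine ⟨x 0 / lam 0, ?_⟩
    funext i
    fin_cases i
    · simp [div_mul_cancel₀ _ hl0]
    · simp [hx1, hl1]
  · -- `θ 0 ≠ 0`: then `lam 1 ≠ 0` and both `lam`, `x` are determined by their second coordinate
    have hl1 : lam 1 ≠ 0 := by
      intro hl1
      have hl0 : lam 0 = 0 := by
        have : θ 0 * lam 0 = 0 := by simpa [hl1] using hθlam'
        exact (mul_eq_zero.mp this).resolve_left h0
      apply hlam
      funext i
      fin_cases i <;> simp [hl0, hl1]
    refine ⟨x 1 / lam 1, ?_⟩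
    have e1 : θ 0 * x 0 = -(x 1 * θ 1) := by
      rw [mul_comm]
      exact eq_neg_of_add_eq_zero_left hx'
    have e2 : θ 0 * lam 0 = -(θ 1 * lam 1) := eq_neg_of_add_eq_zero_left hθlam'
    have hx0 : x 0 = x 1 / lam 1 * lam 0 := by
      apply mul_left_cancel₀ h0
      rw [e1]
      calc -(x 1 * θ 1) = -(x 1 / lam 1 * lam 1 * θ 1) := by rw [div_mul_cancel₀ _ hl1]
        _ = x 1 / lam 1 * (-(θ 1 * lam 1)) := by ring
        _ = x 1 / lam 1 * (θ 0 * lam 0) := by rw [e2]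
        _ = θ 0 * (x 1 / lam 1 * lam 0) := by ring
    funext i
    fin_cases i
    · simpa using hx0
    · simp [div_mul_cancel₀ _ hl1]

/-- A `2 × 2` matrix whose rows are orthogonal to `θ` (i.e. `X θ = 0`) lies on the column plane
`{z λᵀ}` when `θ ⊥ λ` (`θ, λ ≠ 0`). -/
theorem exists_eq_vecMulVec_of_mulVec_eq_zero {θ lam : Fin 2 → k} (hθ : θ ≠ 0) (hlam : lam ≠ 0)
    (hθlam : θ ⬝ᵥ lam = 0) {X : Matrix (Fin 2) (Fin 2) k} (hX : X *ᵥ θ = 0) :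
    ∃ z : Fin 2 → k, X = vecMulVec z lam := by
  have hrow : ∀ a : Fin 2, ∃ c : k, X a = c • lam := fun a =>
    exists_eq_smul_of_dotProduct_eq_zero hθ hlam hθlam (by
      have := congrFun hX a
      simpa [mulVec, dotProduct] using this)
  choose z hz using hrow
  refine ⟨z, ?_⟩
  ext a b
  rw [vecMulVec_apply, hz a, Pi.smul_apply, smul_eq_mul]

/-- **X-side of the block law.** An X-form vanishing on the column plane `{z λᵀ}` factors through
`X ↦ X θ` (`θ ⊥ λ`): it takes equal values on matrices with the same `X θ`. For the saturated plane
of `mul_vecMulVec_eq_sum_filter_of_card_eq` this says `f_i(X) = a_i · (Xθ)` for `i ∈ R`, so that on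
`Y = θ wᵀ` the `R`-terms compute the outer product `(Xθ) ⊗ w`. -/
theorem dual_apply_eq_of_mulVec_eq {θ lam : Fin 2 → k} (hθ : θ ≠ 0) (hlam : lam ≠ 0)
    (hθlam : θ ⬝ᵥ lam = 0) (f : Module.Dual k (Matrix (Fin 2) (Fin 2) k))
    (hf : ∀ z : Fin 2 → k, f (vecMulVec z lam) = 0) {X X' : Matrix (Fin 2) (Fin 2) k}
    (h : X *ᵥ θ = X' *ᵥ θ) : f X = f X' := by
  have hsub : (X - X') *ᵥ θ = 0 := by rw [Matrix.sub_mulVec, h, sub_self]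
  obtain ⟨z, hz⟩ := exists_eq_vecMulVec_of_mulVec_eq_zero hθ hlam hθlam hsub
  have h0 : f (X - X') = 0 := by rw [hz]; exact hf z
  rwa [map_sub, sub_eq_zero] at h0

end Summit.MatrixMultiplication.OmegaCensus.RankOnePlaneCapGeneral
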